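import Literature.MathematicalPhysics.QuantumFieldTheory.Balaban1983to89.B12Average012Permutation

/-!
# [Balaban1987RG1] p. 252 for the tree's (42): Bałaban's block average (42) of [Balaban1985Averaging] (CORNER blocks, ONE tree
# contour ordering — the tree's `B7Prop1Explicit.bavg`) is NOT equivariant under lattice Euclidean transformations — a kernel
# witness under the axis transposition of `ℤ²`, `L = 2`, for a `U(1)`-valued single-defect configuration

CITATION HEADER.  T. Bałaban, *Renormalization group approach to lattice gauge field theories. I*, Commun. Math. Phys. **109** (1987)
249–301 [Balaban1987RG1], p. 252 (held text `paper:balaban1987-cmp109-rg-i-small-field` p0004, re-read 2026-08-27): «Renormalization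
transformations are defined by averaging operations. In the previous papers we have used the definition introduced in [12]. This
definition has one disadvantage, it is not symmetric with respect to lattice Euclidean transformations. Preserving this symmetry is very
important for the method; therefore it is necessary to modify the definition.» — [12] = T. Bałaban, *Averaging operations for lattice gauge
theories*, Commun. Math. Phys. **98** (1985) 17–51 [Balaban1985Averaging], whose average is (15) p. 19 = (42) p. 23 over the corner blocks
(2) p. 17 `B(y) = {x : y_μ ≤ x_μ < y_μ + L}` with the tree contours `Γ_{y,x}` of [Balaban1984PropagatorsI] (1.7) (coordinates changed in ONE
fixed order) — in the tree `B7Prop1Explicit.bavg L V q κ` (`treeWord`: the `d`-th coordinate first, the first last; `boxVec`: corner blocks).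

WHAT THIS MODULE PROVES (kernel; cell `pub-ymgap`, seat `pub-ymgap-dag-n16-w3`, the «mismatch as a statement» half of the N16 averaging pin,
companion of `Summits/…/Theorems/BalabanUVNodesN16AveragingPin.lean`).  §1 over the lit-balaban lineage's axis-relabelling action `B12Average012Permutation.permSite ∕ permCfg`
([Balaban1987RG1] (2.17) «(rU)(b) = U(rb)» for axis permutations of `ℤ^d`), the EQUIVARIANCE SHAPE `PermEquivariantAt` a Euclidean-symmetric
one-step average satisfies — PROVED in the tree for [I]'s own averages: the (0.11)∕(0.12) average `\overline{rU} = rŪ`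
(`B12Average012Permutation.avgBar_permE`, all contour orderings) and the (0.4)-shaped torus averaging (`BlockAveraging.avgFun_permute`) —, single-defect configurations
`defectCfg x₀ κ₀ g` (value `g` on the one bond `⟨x₀, x₀ + e_{κ₀}⟩`, `1` elsewhere) and their holonomies `hol (defectCfg x₀ κ₀ g) x w = g ^ passes x₀ κ₀ x w`
(`passes` = the signed number of traversals of that bond by the word — computable bookkeeping).  §2 THE WITNESS (`d = 2`, `L = 2`, `𝔸 = ℂ`,
`g = e^{i/2} ∈ U(1)`): for the defect on the bond `⟨(1,0), (1,1)⟩` (direction `e₁`, off the corner line) EVERY (42)-loop of the coarse bond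
`⟨0, 2e₀⟩` misses the defect (`bavg_Vdef`: `V̄ = 1` there), while after transposing the axes (`permCfg swap`: the defect sits on
`⟨(0,1), (1,1)⟩`, direction `e₀`) exactly ONE of the four loops of the transposed bond `⟨0, 2e₁⟩` — the block point `(1,1)` — crosses it once
(`passes` = 1; the other three and the straight transporter: 0), so `V̄ = e^{i/8} ≠ 1` (`val_bavg_permCfg_Vdef`); hence
**`not_permEquivariant_bavg`**: `¬ PermEquivariantAt (bavg 2) swap` on `ℤ²` — (42) with its printed corner-block ∕ fixed-ordering conventions is
not Euclidean symmetric, as p. 252 says (`bavg_permCfg_ne`: the two sides of the identity differ at `Vdef`).  The mechanism: (42) reads ONE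
tree contour `Γ_{c₋,x}` per block point, changing the coordinates in a FIXED order (`treeWord`: the `d`-th first), so WHICH bonds of a block its
loops visit is not invariant under exchanging the axes; [I]'s (0.4) ∕ (0.11)–(0.12) symmetrise over all orderings (and centre the blocks, which
in addition restores the reflections that corner blocks break — cf. `B12Average012Permutation` DIVERGENCE (a): permutations only there).

HONEST FRAMING.  A kernel certificate of ONE printed sentence ([Balaban1987RG1] p. 252) for the tree's typed (42); scalar (`U(1) ⊂ ℂ`) valued
configuration, `d = 2`, `L = 2` — the smallest instance; nothing about (0.4) is proved here (its symmetry is `BlockAveraging` §4's), nothing of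
Bałaban's estimates is asserted; no bearing on any node count, on the continuum limit, OS, a mass gap or Clay.  No `sorry`, no `instance`, no
`notation`.
-/

noncomputable section

open scoped BigOperators
open NormedSpace

namespace Literature.MathematicalPhysics.QuantumFieldTheory.Balaban1983to89.B7Eq42NotEuclideanSymmetric

open B7Prop1Explicit MatrixLog B7BlockAvgLog
open B12Average012Permutation (permSite permCfg permSite_apply permCfg_apply)

variable {d : ℕ}

/-! ## §1 Axis relabelling, the equivariance shape, single-defect configurations and their holonomies -/

/-- **EQUIVARIANCE OF A ONE-STEP AVERAGE UNDER AN AXIS PERMUTATION** (the shape a «lattice Euclidean symmetric» averaging has, [Balaban1987RG1]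
p. 252; for the (0.4)-shaped torus averaging it is `BlockAveraging.avgFun_permute`): averaging the relabelled configuration = relabelling the
averaged one.  A SHAPE; §2 refutes it for (42). [cite: Balaban1987RG1, (2.17) p.269] -/
def PermEquivariantAt {G : Type*} (av : (B7Prop1Explicit.Site d → Fin d → G) → (B7Prop1Explicit.Site d → Fin d → G)) (σ : Equiv.Perm (Fin d)) : Prop :=
  ∀ V : B7Prop1Explicit.Site d → Fin d → G, av (permCfg σ V) = permCfg σ (av V)

section Defect

variable {G : Type*} [Group G]

/-- **SINGLE-DEFECT CONFIGURATION**: the bond `⟨x₀, x₀ + e_{κ₀}⟩` carries `g`, every other bond `1`. [folklore] -/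
def defectCfg (x₀ : B7Prop1Explicit.Site d) (κ₀ : Fin d) (g : G) : B7Prop1Explicit.Site d → Fin d → G :=
  fun x κ => if x = x₀ ∧ κ = κ₀ then g else 1

/-- The SIGNED NUMBER OF TRAVERSALS of the bond `⟨x₀, x₀ + e_{κ₀}⟩` by the word `w` spelled from `x` (`+1` forward, `−1` backward) —
computable bookkeeping. [folklore] -/
def passes (x₀ : B7Prop1Explicit.Site d) (κ₀ : Fin d) : B7Prop1Explicit.Site d → List (Letter d) → ℤ
  | _, [] => 0
  | x, l :: w => (if l.1 = κ₀ then (if l.2 then (if x = x₀ then 1 else 0) else (if x + l.vec = x₀ then -1 else 0)) else 0)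
      + passes x₀ κ₀ (x + l.vec) w

/-- One letter of a single-defect configuration contributes `g^{±1}` on the defect bond and `1` elsewhere. [cite: Balaban1985Averaging, (9) p.18 (bookkeeping)] -/
theorem stepHol_defectCfg (x₀ : B7Prop1Explicit.Site d) (κ₀ : Fin d) (g : G) (x : B7Prop1Explicit.Site d) (l : Letter d) :
    stepHol (defectCfg x₀ κ₀ g) x l =
      g ^ (if l.1 = κ₀ then (if l.2 then (if x = x₀ then (1 : ℤ) else 0) else (if x + l.vec = x₀ then -1 else 0)) else 0) := by
  obtain ⟨μ, b⟩ := l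
  cases b
  · simp only [stepHol, defectCfg, Bool.false_eq_true, ↓reduceIte, Letter.vec_false]
    by_cases hμ : μ = κ₀
    · subst hμ
      by_cases hx : x + -e μ = x₀
      · simp [hx]
      · simp [hx]
    · simp [hμ]
  · simp only [stepHol, defectCfg, ↓reduceIte]
    by_cases hμ : μ = κ₀
    · by_cases hx : x = x₀
      · simp [hμ, hx]
      · simp [hμ, hx]
    · simp [hμ]

/-- **HOLONOMY OF A SINGLE-DEFECT CONFIGURATION**: `V(Γ) = g ^ (signed traversals of the defect bond)`. [cite: Balaban1985Averaging, (9) p.18 (bookkeeping)] -/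
theorem hol_defectCfg (x₀ : B7Prop1Explicit.Site d) (κ₀ : Fin d) (g : G) : ∀ (x : B7Prop1Explicit.Site d) (w : List (Letter d)),
    hol (defectCfg x₀ κ₀ g) x w = g ^ passes x₀ κ₀ x w
  | x, [] => by simp [passes]
  | x, l :: w => by
    rw [hol_cons, stepHol_defectCfg, hol_defectCfg x₀ κ₀ g (x + l.vec) w, passes, ← zpow_add]

end Defect

/-! ## §2 The witness on `ℤ²`, `L = 2`: (42) is not equivariant under the transposition of the axes -/

section Witness

/-- The transposition of the two axes of `ℤ²`. [folklore] -/
def swap : Equiv.Perm (Fin 2) := Equiv.swap 0 1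

/-- The defect phase `g = e^{i/2} ∈ U(1) ⊂ ℂˣ` (any small non-trivial phase would do). [folklore] -/
def gph : ℂˣ := expUnit ((2 : ℂ)⁻¹ * Complex.I)

/-- THE CONFIGURATION: the defect on the `e₁`-bond at the site `(1, 0)` of the corner block of `0` (off the corner line `x₀ = 0`). [folklore] -/
def Vdef : B7Prop1Explicit.Site 2 → Fin 2 → ℂˣ := defectCfg ![1, 0] 1 gph

/-- Its axis transpose: the defect on the `e₀`-bond at `(0, 1)`. [cite: Balaban1987RG1, (2.17) p.269 (bookkeeping)] -/
theorem permCfg_swap_Vdef : permCfg swap Vdef = defectCfg ![0, 1] 0 gph := by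
  funext x κ
  simp only [permCfg_apply, Vdef, defectCfg, swap]
  have hκ : (Equiv.swap (0 : Fin 2) 1) κ = 1 ↔ κ = 0 := by
    constructor
    · intro h
      have := congrArg (Equiv.swap (0 : Fin 2) 1) h
      simpa using this
    · rintro rfl; simp
  have hx : permSite (Equiv.swap (0 : Fin 2) 1) x = ![1, 0] ↔ x = ![0, 1] := by
    constructor
    · intro h
      have h0 := congrFun h 0
      have h1 := congrFun h 1
      simp only [permSite_apply, Equiv.symm_swap, Equiv.swap_apply_left, Equiv.swap_apply_right, Matrix.cons_val_zero,
        Matrix.cons_val_one] at h0 h1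
      funext i; fin_cases i <;> simp [h0, h1]
    · rintro rfl
      funext i; fin_cases i <;> simp [permSite_apply]
  simp only [hκ, hx]

/-! ### The traversal counts (computable; `decide`) -/

/-- Side A: NO (42)-loop of the coarse bond `⟨0, 2e₀⟩` and not its straight transporter crosses the `e₁`-bond at `(1,0)`. [cite: Balaban1985Averaging, (42) p.23 (bookkeeping)] -/
theorem passes_sideA (r : Fin 2 → Fin 2) :
    passes ![1, 0] 1 0 (gammaWord 2 0 (boxVec 2 r)) = 0 ∧ passes ![1, 0] 1 (0 : B7Prop1Explicit.Site 2) (seg 0 ((2 : ℕ) : ℤ)) = 0 := by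
  have hr : r = ![r 0, r 1] := by funext i; fin_cases i <;> rfl
  rw [hr]
  rcases Fin.exists_fin_two.mp ⟨r 0, rfl⟩ with h0 | h0 <;> rcases Fin.exists_fin_two.mp ⟨r 1, rfl⟩ with h1 | h1 <;>
    rw [h0, h1] <;> decide

/-- Side B: among the (42)-loops of the coarse bond `⟨0, 2e₁⟩` exactly the one through the block point `(1,1)` crosses the `e₀`-bond at
`(0,1)`, once, forward; the straight transporter does not. [cite: Balaban1985Averaging, (42) p.23 (bookkeeping)] -/
theorem passes_sideB (r : Fin 2 → Fin 2) :
    passes ![0, 1] 0 0 (gammaWord 2 1 (boxVec 2 r)) = (if r = ![1, 1] then 1 else 0) ∧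
      passes ![0, 1] 0 (0 : B7Prop1Explicit.Site 2) (seg 1 ((2 : ℕ) : ℤ)) = 0 := by
  have hr : r = ![r 0, r 1] := by funext i; fin_cases i <;> rfl
  rw [hr]
  rcases Fin.exists_fin_two.mp ⟨r 0, rfl⟩ with h0 | h0 <;> rcases Fin.exists_fin_two.mp ⟨r 1, rfl⟩ with h1 | h1 <;>
    rw [h0, h1] <;> decide

/-! ### Side A: the (42) average of `Vdef` at the coarse bond `⟨0, 2e₀⟩` is trivial -/

/-- Every (42)-loop variable `V(Γ_{c,x})V(c)⁻¹` of `Vdef` at `c = ⟨0, 2e₀⟩` is `1`. [cite: Balaban1985Averaging, (42) p.23 (bookkeeping)] -/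
theorem Wcx_Vdef (r : Fin 2 → Fin 2) : Wcx 2 Vdef 0 0 (boxVec 2 r) = 1 := by
  obtain ⟨h1, h2⟩ := passes_sideA r
  rw [Wcx, Vdef, hol_defectCfg, hol_defectCfg, h1, h2]
  simp

/-- Hence the exponent (42) vanishes there. [cite: Balaban1985Averaging, (42) p.23 (bookkeeping)] -/
theorem Xavg_Vdef : Xavg 2 Vdef 0 0 = 0 := by
  simp [Xavg, Wcx_Vdef, mlog_one]

/-- **SIDE A**: `V̄_c = 1` for `Vdef` at `c = ⟨0, 2e₀⟩` (no loop and not the straight transporter meets the defect). [cite: Balaban1985Averaging, (42) p.23 (bookkeeping)] -/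
theorem bavg_Vdef : bavg 2 Vdef 0 0 = 1 := by
  show expUnit (Xavg 2 Vdef 0 0) * hol Vdef 0 (seg 0 ((2 : ℕ) : ℤ)) = 1
  rw [Xavg_Vdef, Vdef, hol_defectCfg, (passes_sideA fun _ => 0).2, zpow_zero, mul_one]
  exact Units.ext (by simp)

/-! ### Side B: the (42) average of the transposed configuration at the transposed bond `⟨0, 2e₁⟩` is `e^{i/8}` -/

/-- The loop variables of the transposed configuration at `c′ = ⟨0, 2e₁⟩`: `g` for the block point `(1,1)`, `1` otherwise. [cite: Balaban1985Averaging, (42) p.23 (bookkeeping)] -/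
theorem Wcx_permCfg_Vdef (r : Fin 2 → Fin 2) :
    Wcx 2 (permCfg swap Vdef) 0 1 (boxVec 2 r) = if r = ![1, 1] then gph else 1 := by
  obtain ⟨h1, h2⟩ := passes_sideB r
  rw [permCfg_swap_Vdef, Wcx, hol_defectCfg, hol_defectCfg, h1, h2]
  split_ifs <;> simp

/-- The defect phase is within the domain of the logarithm series: `log e^{i/2} = i/2` (`B7BlockAvgLog.mlog_exp`, `1/2 < ln 2`). [cite: Balaban1985Averaging, (21) p.21 (bookkeeping)] -/
theorem mlog_gph : mlog ((gph : ℂˣ) : ℂ) = (2 : ℂ)⁻¹ * Complex.I := by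
  show mlog (exp ((2 : ℂ)⁻¹ * Complex.I)) = _
  apply mlog_exp
  rw [norm_mul, Complex.norm_I, mul_one, norm_inv, Complex.norm_ofNat]
  have := Real.log_two_gt_d9
  norm_num at this ⊢
  linarith

/-- The exponent (42) of the transposed configuration at `c′`: `L^{−d} · log g = (1/4)(i/2)`. [cite: Balaban1985Averaging, (42) p.23 (bookkeeping)] -/
theorem Xavg_permCfg_Vdef : Xavg 2 (permCfg swap Vdef) 0 1 = (((2 : ℝ) ^ 2)⁻¹) • ((2 : ℂ)⁻¹ * Complex.I) := by
  simp only [Xavg, Wcx_permCfg_Vdef]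
  rw [Finset.sum_eq_single (![1, 1] : Fin 2 → Fin 2)]
  · rw [if_pos rfl, mlog_gph]; norm_num
  · intro r _ hr
    rw [if_neg hr, Units.val_one, mlog_one, smul_zero]
  · intro h; exact absurd (Finset.mem_univ _) h

/-- **SIDE B**: `V̄_{c′} = e^{i/8}` for the transposed configuration at `c′ = ⟨0, 2e₁⟩`. [cite: Balaban1985Averaging, (42) p.23 (bookkeeping)] -/
theorem val_bavg_permCfg_Vdef : ((bavg 2 (permCfg swap Vdef) 0 1 : ℂˣ) : ℂ) = Complex.exp ((8 : ℂ)⁻¹ * Complex.I) := by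
  show ((expUnit (Xavg 2 (permCfg swap Vdef) 0 1) * hol (permCfg swap Vdef) 0 (seg 1 ((2 : ℕ) : ℤ)) : ℂˣ) : ℂ) = _
  rw [Xavg_permCfg_Vdef, permCfg_swap_Vdef, hol_defectCfg, (passes_sideB fun _ => 0).2, zpow_zero, mul_one, val_expUnit,
    congr_fun Complex.exp_eq_exp_ℂ ((8 : ℂ)⁻¹ * Complex.I)]
  congr 1
  rw [Complex.real_smul]
  push_cast
  ring

/-- `e^{i/8} ≠ 1` (`1/8 ∉ 2πℤ`). [folklore] -/
private theorem exp_I_div_eight_ne_one : Complex.exp ((8 : ℂ)⁻¹ * Complex.I) ≠ 1 := by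
  intro h
  obtain ⟨n, hn⟩ := Complex.exp_eq_one_iff.mp h
  have him := congrArg Complex.im hn
  simp only [Complex.mul_im, Complex.inv_im, Complex.I_re, Complex.I_im, Complex.inv_re, Complex.mul_re,
    Complex.ofReal_im, Complex.ofReal_re, Complex.intCast_re, Complex.intCast_im, Complex.re_ofNat, Complex.im_ofNat] at him
  norm_num at him
  -- him : 8⁻¹ = n * (2 * π)  (up to normalisation)
  have hπ := Real.pi_gt_three
  rcases lt_trichotomy n 0 with hn0 | rfl | hn0
  · have : (n : ℝ) ≤ -1 := by exact_mod_cast Int.le_sub_one_of_lt hn0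
    nlinarith
  · norm_num at him
  · have : (1 : ℝ) ≤ n := by exact_mod_cast hn0
    nlinarith

/-- The transposed coarse bond reads the ORIGINAL average at `⟨0, 2e₀⟩` (`π⁻¹ • 0 = 0`, `π⁻¹ 1 = 0`). [cite: Balaban1985Averaging, (42) p.23 (bookkeeping)] -/
theorem permCfg_bavg_Vdef : permCfg swap (bavg 2 Vdef) 0 1 = bavg 2 Vdef 0 0 := by
  have h0 : permSite swap (0 : B7Prop1Explicit.Site 2) = 0 := by funext i; simp [permSite_apply]
  rw [permCfg_apply, h0]
  simp [swap]

/-- **[Balaban1987RG1] p. 252 FOR THE TREE's (42), KERNEL**: Bałaban's block average (42) of [Balaban1985Averaging] (corner blocks, one fixed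
tree-contour ordering — `B7Prop1Explicit.bavg`) is NOT equivariant under the transposition of the axes of `ℤ²` (`L = 2`), already for
`U(1)`-valued configurations: the single-defect configuration `Vdef` has `V̄ = 1` at `⟨0, 2e₀⟩` but its transpose has `V̄ = e^{i/8}` at the
transposed bond. «This definition has one disadvantage, it is not symmetric with respect to lattice Euclidean transformations» (p. 252) —
certified. [cite: Balaban1987RG1, p.252] -/
theorem not_permEquivariant_bavg : ¬ PermEquivariantAt (G := ℂˣ) (bavg 2) swap := by
  intro h
  have h1 : bavg 2 (permCfg swap Vdef) 0 1 = permCfg swap (bavg 2 Vdef) 0 1 := by rw [h Vdef]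
  rw [permCfg_bavg_Vdef, bavg_Vdef] at h1
  have hval := congrArg (fun u : ℂˣ => (u : ℂ)) h1
  simp only [val_bavg_permCfg_Vdef, Units.val_one] at hval
  exact exp_I_div_eight_ne_one hval

/-- The same, unfolded: the two sides of the equivariance identity DIFFER at the configuration `Vdef`, bond `⟨0, 2e₁⟩`. [cite: Balaban1987RG1, p.252] -/
theorem bavg_permCfg_ne : bavg 2 (permCfg swap Vdef) 0 1 ≠ permCfg swap (bavg 2 Vdef) 0 1 := by
  intro h1
  rw [permCfg_bavg_Vdef, bavg_Vdef] at h1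
  have hval := congrArg (fun u : ℂˣ => (u : ℂ)) h1
  simp only [val_bavg_permCfg_Vdef, Units.val_one] at hval
  exact exp_I_div_eight_ne_one hval

end Witness

end Literature.MathematicalPhysics.QuantumFieldTheory.Balaban1983to89.B7Eq42NotEuclideanSymmetric

end
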